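import Mathlib.Analysis.SpecialFunctions.Pow.Real
import Mathlib.Analysis.SpecialFunctions.Sqrt
import Summits.NavierStokesRegularity.TurbBounds.LadderTail
import Summits.NavierStokesRegularity.TurbBounds.ShearTailRule
import HarnessLib

/-!
# The fw16 shear tail lemma R-T at the coefficient-sequence level, generic in `(N, P)` (rbsdp SPEC 2.6–2.7; FW16 App. C)

Cell `turb-bounds` (pub-turb), shear lane, pub-turb-shear gen 6 (2026-08-22); v2 lane (LEAN-MAP; lead decision 92 (5)).
Source of record: HOME/code/rbsdp/SPEC.md §2.3–2.7 (= Fantuzzi–Wynn, PRE 93 (2016) 043308, App. C (C2)–(C4) + the cell's H0/λ0 and fixed δ),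
refereed as prose lemma R-T (HOME/tribunal/t-lemmas.md). This file is PURE SEQUENCE ALGEBRA over `ℝ`, on cert's `LadderTail` toolbox
(`w`, `IsLadder`, `phi`, `chi`, `lam`, `sum_bound`, `phi_add_chi_le`): no polynomials, no integrals, no fluid mechanics.

With `c`, `a`, `b` the Legendre coefficient sequences of `W″`, `W′`, `W` (one real component; `IsLadder c a`, `IsLadder a b` = SPEC 1.2 using
`W′(−1) = 0`, `W(−1) = 0`), truncation orders `N ≥ 0`, `P ≥ 0`, `J := N + P + 4`, and the (finite-window) tails
`T2 = Σ_{k<L} w_{J+k} c_{J+k}²` (of `W″` from `J`), `T1 = Σ_{k<L} w_{N+2+k} a_{N+2+k}²` (of `W′` from `N+2`), `T0 = Σ_{k<L} w_{N+1+k} b_{N+1+k}²` (of `W` from `N+1`):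
* `window_tail_bound` — the generic ladder tail lemma with a tracked window of ANY width `q + 2` (cert's `LadderTail.tail_bound` is `q = 0`):
  `Σ_{k<L} w_{J'+1+k} u² ≤ Σ_{k<q+2} φ_{J'+k} v² + Σ_{k<q} χ_{J'+2+k} v² + lam (J'+q) · Σ_{k<L} w_{J'+q+2+k} v²`;
* `tail1_bound` — SPEC 2.6 CLAIM 1 (FW16 (C2)–(C4)): `T1 ≤ H1form N P c + λ1 · T2`, `H1form = Σ_{j=N+1}^{N+P+3} φ_j c_j² + Σ_{j=N+3}^{N+P+3} χ_j c_j²`,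
  `λ1 = lam (N+P+2) = 4/((2J−1)(2J+3))`;
* `tail0_bound` — SPEC 2.6 CLAIM 2 (the cell's H0/λ0): `T0 ≤ G0form N a + μ·(H1form N P c + λ1·T2) = H0form + λ0·T2`, `G0form = φ_N a_N² + φ_{N+1} a_{N+1}²`, `μ = lam N`;
* `rem_lower_bound` (and `rem_lower_bound_young`, Young-form hypothesis `|X_t| ≤ T((δ/2)T0 + T1/(2δ))`) — SPEC 2.7 (the Young split with a fixed weight `δ > 0`, real arithmetic): from the two claims, `|X_t| ≤ T·√T1·√T0`, `C, D, T ≥ 0`: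
  `A·T2 + 8·T1 + C·T0 − D·X_t ≥ −T·D·((δ/2)·H0f + (1/(2δ))·H1f) + (A − D·((δ/2)·λ0 + (1/(2δ))·λ1)·T)·T2`;
* `pair_tail1_bound` / `pair_tail0_bound` — the same claims for the two real components `(x, y)` of a complex `W` added up;
* the link to the landed RULE file `ShearTailRule` (whose values the rows' `TailSlack` files kernel-check): `lam1_cast : (ShearTailRule.lam1 N P : ℝ) = lam (N+P+2)`,
  `mu_cast : (ShearTailRule.mu N : ℝ) = lam N`, `kappaTilde_cast` — so the certified scalar line `A_m − κ̃_m·T ≥ 0` IS the coefficient of `T2` above.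
What this file does NOT do (later v2 files, as for P2-R0's `TailBridge`/`TailPoly`/`LayerDensity`): identify `H1form/G0form` and the finite part with the
literal piece matrices of `Certs/<Row>/EvalPieces*` (Legendre–Galerkin bridge), pass from polynomial to admissible `W` (density), the cited reduction.
HONEST FRAMING: rigorous bounds for the stated PDE and boundary conditions; no claim about physical turbulence beyond the bound.
-/

set_option linter.style.longLine false

namespace Summit.NavierStokesRegularity.TurbBounds.ShearTailSeq

open Finset Summit.NavierStokesRegularity.TurbBounds.LadderTail

/-! ### The generic window tail lemma -/

/-- A weighted window of squares is nonnegative. -/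
theorem window_nonneg (f : ℕ → ℝ) (s L : ℕ) : 0 ≤ ∑ k ∈ range L, w (s + k) * f (s + k) ^ 2 :=
  sum_nonneg fun _ _ => mul_nonneg (w_pos _).le (sq_nonneg _)

/-- **Generic ladder tail lemma with a tracked window of width `q + 2`** (rbsdp SPEC 3.4 / FW16 App. C pattern): if `IsLadder v u` then for all `J q L`,
`Σ_{k<L} w_{J+1+k} u_{J+1+k}² ≤ Σ_{k<q+2} φ_{J+k} v_{J+k}² + Σ_{k<q} χ_{J+2+k} v_{J+2+k}² + lam (J+q) · Σ_{k<L} w_{J+q+2+k} v_{J+q+2+k}²`.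
(`q = 0` is `LadderTail.tail_bound`.) -/
theorem window_tail_bound {v u : ℕ → ℝ} (h : IsLadder v u) (J q L : ℕ) :
    ∑ k ∈ range L, w (J + 1 + k) * u (J + 1 + k) ^ 2
      ≤ ∑ k ∈ range (q + 2), phi (J + k) * v (J + k) ^ 2
        + ∑ k ∈ range q, chi (J + 2 + k) * v (J + 2 + k) ^ 2
        + lam (J + q) * ∑ k ∈ range L, w (J + q + 2 + k) * v (J + q + 2 + k) ^ 2 := by
  have hs := sum_bound h J L
  -- extend the `φ`-sum to the window `range (q + 2 + L)` and split it
  have hφ : ∑ k ∈ range L, phi (J + k) * v (J + k) ^ 2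
      ≤ ∑ k ∈ range (q + 2), phi (J + k) * v (J + k) ^ 2
        + ∑ k ∈ range L, phi (J + q + 2 + k) * v (J + q + 2 + k) ^ 2 := by
    have hext : ∑ k ∈ range L, phi (J + k) * v (J + k) ^ 2 ≤ ∑ k ∈ range (q + 2 + L), phi (J + k) * v (J + k) ^ 2 :=
      sum_le_sum_of_subset_of_nonneg (range_subset_range.mpr (by omega)) fun k _ _ =>
        mul_nonneg (phi_nonneg _) (sq_nonneg _)
    rw [sum_range_add] at hext
    have e : ∑ k ∈ range L, phi (J + (q + 2 + k)) * v (J + (q + 2 + k)) ^ 2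
        = ∑ k ∈ range L, phi (J + q + 2 + k) * v (J + q + 2 + k) ^ 2 :=
      sum_congr rfl fun k _ => by rw [show J + (q + 2 + k) = J + q + 2 + k by omega]
    rw [e] at hext
    exact hext
  -- extend the `χ`-sum to the window `range (q + L)` and split it
  have hχ : ∑ k ∈ range L, chi (J + 2 + k) * v (J + 2 + k) ^ 2
      ≤ ∑ k ∈ range q, chi (J + 2 + k) * v (J + 2 + k) ^ 2
        + ∑ k ∈ range L, chi (J + q + 2 + k) * v (J + q + 2 + k) ^ 2 := by
    have hext : ∑ k ∈ range L, chi (J + 2 + k) * v (J + 2 + k) ^ 2 ≤ ∑ k ∈ range (q + L), chi (J + 2 + k) * v (J + 2 + k) ^ 2 :=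
      sum_le_sum_of_subset_of_nonneg (range_subset_range.mpr (by omega)) fun k _ _ =>
        mul_nonneg (chi_nonneg (by omega)) (sq_nonneg _)
    rw [sum_range_add] at hext
    have e : ∑ k ∈ range L, chi (J + 2 + (q + k)) * v (J + 2 + (q + k)) ^ 2
        = ∑ k ∈ range L, chi (J + q + 2 + k) * v (J + q + 2 + k) ^ 2 :=
      sum_congr rfl fun k _ => by rw [show J + 2 + (q + k) = J + q + 2 + k by omega]
    rw [e] at hext
    exact hext
  -- on the untracked window, `φ + χ ≤ lam (J+q) · w`
  have hcomb : ∑ k ∈ range L, phi (J + q + 2 + k) * v (J + q + 2 + k) ^ 2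
        + ∑ k ∈ range L, chi (J + q + 2 + k) * v (J + q + 2 + k) ^ 2
      ≤ lam (J + q) * ∑ k ∈ range L, w (J + q + 2 + k) * v (J + q + 2 + k) ^ 2 := by
    rw [← sum_add_distrib, mul_sum]
    refine sum_le_sum fun k _ => ?_
    have hle := phi_add_chi_le (J + q) k
    have hv : 0 ≤ v (J + q + 2 + k) ^ 2 := sq_nonneg _
    calc phi (J + q + 2 + k) * v (J + q + 2 + k) ^ 2 + chi (J + q + 2 + k) * v (J + q + 2 + k) ^ 2
        = (phi (J + q + 2 + k) + chi (J + q + 2 + k)) * v (J + q + 2 + k) ^ 2 := by ring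
      _ ≤ (lam (J + q) * w (J + q + 2 + k)) * v (J + q + 2 + k) ^ 2 := mul_le_mul_of_nonneg_right hle hv
      _ = lam (J + q) * (w (J + q + 2 + k) * v (J + q + 2 + k) ^ 2) := by ring
  linarith [hs, hφ, hχ, hcomb]

/-! ### The fw16 forms (rbsdp SPEC 2.6) at the sequence level -/

/-- SPEC 2.6 / FW16 (C2)–(C4): the tracked part of the `W′`-tail bound, `H1form N P c = Σ_{j=N+1}^{N+P+3} φ_j c_j² + Σ_{j=N+3}^{N+P+3} χ_j c_j²`
(a diagonal quadratic form in the tracked coefficients `c_0 … c_{N+P+3}` of `W″`). -/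
noncomputable def H1form (N P : ℕ) (c : ℕ → ℝ) : ℝ :=
  ∑ k ∈ range (P + 3), phi (N + 1 + k) * c (N + 1 + k) ^ 2 + ∑ k ∈ range (P + 1), chi (N + 3 + k) * c (N + 3 + k) ^ 2

/-- SPEC 2.6 (ours): the tracked part `G0` of the `W`-tail bound, `G0form N a = φ_N a_N² + φ_{N+1} a_{N+1}²` (in the coefficients of `W′`;
the bridge substitutes `a = D1 c`). -/
noncomputable def G0form (N : ℕ) (a : ℕ → ℝ) : ℝ := phi N * a N ^ 2 + phi (N + 1) * a (N + 1) ^ 2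

/-- SPEC 2.6: `λ1 = 4/((2J−1)(2J+3))`, `J = N+P+4`, i.e. `lam (N+P+2)`. -/
noncomputable def lam1 (N P : ℕ) : ℝ := lam (N + P + 2)

/-- SPEC 2.6 (ours): `μ = 4/((2N+3)(2N+7)) = lam N`. -/
noncomputable def mu (N : ℕ) : ℝ := lam N

/-- SPEC 2.6 (ours): `λ0 = μ·λ1`. -/
noncomputable def lam0 (N P : ℕ) : ℝ := mu N * lam1 N P

/-- SPEC 2.6 (ours): `H0form = G0form + μ·H1form`. -/
noncomputable def H0form (N P : ℕ) (c a : ℕ → ℝ) : ℝ := G0form N a + mu N * H1form N P c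

/-- `H1form ≥ 0`. -/
theorem H1form_nonneg (N P : ℕ) (c : ℕ → ℝ) : 0 ≤ H1form N P c := by
  unfold H1form
  refine add_nonneg (sum_nonneg fun k _ => mul_nonneg (phi_nonneg _) (sq_nonneg _))
    (sum_nonneg fun k _ => mul_nonneg (chi_nonneg (by omega)) (sq_nonneg _))

/-- `G0form ≥ 0`. -/
theorem G0form_nonneg (N : ℕ) (a : ℕ → ℝ) : 0 ≤ G0form N a := by
  unfold G0form
  exact add_nonneg (mul_nonneg (phi_nonneg _) (sq_nonneg _)) (mul_nonneg (phi_nonneg _) (sq_nonneg _))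

/-- `λ1 > 0`. -/
theorem lam1_pos (N P : ℕ) : 0 < lam1 N P := lam_pos _

/-- `μ > 0`. -/
theorem mu_pos (N : ℕ) : 0 < mu N := lam_pos _

/-- `λ0 > 0`. -/
theorem lam0_pos (N P : ℕ) : 0 < lam0 N P := mul_pos (mu_pos N) (lam1_pos N P)

/-- `H0form ≥ 0`. -/
theorem H0form_nonneg (N P : ℕ) (c a : ℕ → ℝ) : 0 ≤ H0form N P c a :=
  add_nonneg (G0form_nonneg N a) (mul_nonneg (mu_pos N).le (H1form_nonneg N P c))

/-- **SPEC 2.6, CLAIM 1** (FW16 (C2)–(C4)): the weighted tail of `W′` from `N+2` is at most `H1form` plus `λ1` times the weighted tail of `W″` from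
`J = N+P+4` (any window length `L`; the `W″`-window of the same length covers every index the bound touches). -/
theorem tail1_bound {c a : ℕ → ℝ} (hA : IsLadder c a) (N P L : ℕ) :
    ∑ k ∈ range L, w (N + 2 + k) * a (N + 2 + k) ^ 2
      ≤ H1form N P c + lam1 N P * ∑ k ∈ range L, w (N + P + 4 + k) * c (N + P + 4 + k) ^ 2 := by
  have h := window_tail_bound hA (N + 1) (P + 1) L
  unfold H1form lam1
  have e1 : ∀ k, N + 1 + 1 + k = N + 2 + k := fun k => by omega
  have e3 : ∀ k, N + 1 + 2 + k = N + 3 + k := fun k => by omega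
  have e4 : N + 1 + (P + 1) = N + P + 2 := by omega
  have e5 : ∀ k, N + P + 2 + 2 + k = N + P + 4 + k := fun k => by omega
  have e6 : P + 1 + 2 = P + 3 := rfl
  simp only [e1, e3, e4, e5, e6] at h
  exact h

/-- **SPEC 2.6, CLAIM 2** (the cell's `H0/λ0`): the weighted tail of `W` from `N+1` is at most `G0form + μ·(H1form + λ1·T2) = H0form + λ0·T2`. -/
theorem tail0_bound {c a b : ℕ → ℝ} (hA : IsLadder c a) (hB : IsLadder a b) (N P L : ℕ) :
    ∑ k ∈ range L, w (N + 1 + k) * b (N + 1 + k) ^ 2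
      ≤ H0form N P c a + lam0 N P * ∑ k ∈ range L, w (N + P + 4 + k) * c (N + P + 4 + k) ^ 2 := by
  -- tail of `W` from `N+1` ≤ φ_N a_N² + φ_{N+1} a_{N+1}² + μ · (tail of `W′` from `N+2`)
  have h0 := window_tail_bound hB N 0 L
  simp only [sum_range_zero, add_zero] at h0
  have hpeel : ∑ k ∈ range (0 + 2), phi (N + k) * a (N + k) ^ 2 = G0form N a := by
    unfold G0form
    simp [sum_range_succ]
  rw [hpeel] at h0
  have h1 := tail1_bound hA N P L
  have hμ : 0 ≤ mu N := (mu_pos N).le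
  have hchain := mul_le_mul_of_nonneg_left h1 hμ
  unfold H0form lam0
  unfold mu at hchain hμ ⊢
  nlinarith [h0, hchain]

/-! ### The Young split of rbsdp SPEC 2.7 (real arithmetic) -/

/-- Young: `√x·√y ≤ (δ/2)·y + x/(2δ)` for `x, y ≥ 0`, `δ > 0`. -/
theorem sqrt_mul_sqrt_le {x y δ : ℝ} (hx : 0 ≤ x) (hy : 0 ≤ y) (hδ : 0 < δ) :
    Real.sqrt x * Real.sqrt y ≤ δ / 2 * y + x / (2 * δ) := by
  have hsx := Real.sq_sqrt hx
  have hsy := Real.sq_sqrt hy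
  have h2 : 2 * δ * (Real.sqrt x * Real.sqrt y) ≤ 2 * δ * (δ / 2 * y + x / (2 * δ)) := by
    have e : 2 * δ * (δ / 2 * y + x / (2 * δ)) = δ ^ 2 * Real.sqrt y ^ 2 + Real.sqrt x ^ 2 := by
      rw [hsx, hsy]
      field_simp
    rw [e]
    nlinarith [sq_nonneg (Real.sqrt x - δ * Real.sqrt y)]
  exact le_of_mul_le_mul_left h2 (by positivity)

/-- **SPEC 2.7 at the level of real numbers.** Given the two tail claims `T1 ≤ H1f + λ1·T2`, `T0 ≤ H0f + λ0·T2`, the coupling-tail estimate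
`|X_t| ≤ T·√T1·√T0` (Cauchy–Schwarz with `‖φ′‖_∞ ≤ T`), and `C, D ≥ 0`, `δ > 0`:
`A·T2 + 8·T1 + C·T0 − D·X_t ≥ −T·(D·((δ/2)·H0f + H1f/(2δ))) + (A − D·((δ/2)·λ0 + λ1/(2δ))·T)·T2`
(the nonnegative terms `8·T1 + C·T0` are dropped, as in FW16 (C7)). -/
theorem rem_lower_bound {A C D T δ T2 T1 T0 Xt H1f H0f l1 l0 : ℝ}
    (hC : 0 ≤ C) (hD : 0 ≤ D) (hT : 0 ≤ T) (hδ : 0 < δ)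
    (hT1 : 0 ≤ T1) (hT0 : 0 ≤ T0)
    (h1 : T1 ≤ H1f + l1 * T2) (h0 : T0 ≤ H0f + l0 * T2)
    (hX : |Xt| ≤ T * Real.sqrt T1 * Real.sqrt T0) :
    -(T * (D * (δ / 2 * H0f + H1f / (2 * δ)))) + (A - D * (δ / 2 * l0 + l1 / (2 * δ)) * T) * T2
      ≤ A * T2 + 8 * T1 + C * T0 - D * Xt := by
  have hy := sqrt_mul_sqrt_le hT1 hT0 hδ
  -- |Xt| ≤ T (δ/2 T0 + T1/(2δ)) ≤ T (δ/2 (H0f + l0 T2) + (H1f + l1 T2)/(2δ))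
  have hX1 : |Xt| ≤ T * (δ / 2 * T0 + T1 / (2 * δ)) := by
    calc |Xt| ≤ T * Real.sqrt T1 * Real.sqrt T0 := hX
      _ = T * (Real.sqrt T1 * Real.sqrt T0) := by ring
      _ ≤ T * (δ / 2 * T0 + T1 / (2 * δ)) := mul_le_mul_of_nonneg_left hy hT
  have hδ2 : 0 ≤ δ / 2 := by positivity
  have hδ' : 0 < 2 * δ := by positivity
  have hX2 : δ / 2 * T0 + T1 / (2 * δ) ≤ δ / 2 * (H0f + l0 * T2) + (H1f + l1 * T2) / (2 * δ) := by
    have ha := mul_le_mul_of_nonneg_left h0 hδ2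
    have hb := div_le_div_of_nonneg_right h1 hδ'.le
    linarith
  have hX3 : |Xt| ≤ T * (δ / 2 * (H0f + l0 * T2) + (H1f + l1 * T2) / (2 * δ)) :=
    hX1.trans (mul_le_mul_of_nonneg_left hX2 hT)
  have hDX : D * Xt ≤ D * (T * (δ / 2 * (H0f + l0 * T2) + (H1f + l1 * T2) / (2 * δ))) :=
    mul_le_mul_of_nonneg_left ((le_abs_self Xt).trans hX3) hD
  have hdrop : 0 ≤ 8 * T1 + C * T0 := by positivity
  have e : D * (T * (δ / 2 * (H0f + l0 * T2) + (H1f + l1 * T2) / (2 * δ)))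
      = T * (D * (δ / 2 * H0f + H1f / (2 * δ))) + D * (δ / 2 * l0 + l1 / (2 * δ)) * T * T2 := by
    field_simp
    ring
  rw [e] at hDX
  nlinarith [hDX, hdrop]

/-- **SPEC 2.7, Young form of the coupling hypothesis** (the shape of cert's `coupling_tail_bound`: `|X_t| ≤ T·((δ/2)·T0 + T1/(2δ))` at the FIXED
weight `δ`, no square roots): same conclusion as `rem_lower_bound`. -/
theorem rem_lower_bound_young {A C D T δ T2 T1 T0 Xt H1f H0f l1 l0 : ℝ}
    (hC : 0 ≤ C) (hD : 0 ≤ D) (hT : 0 ≤ T) (hδ : 0 < δ)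
    (hT1 : 0 ≤ T1) (hT0 : 0 ≤ T0)
    (h1 : T1 ≤ H1f + l1 * T2) (h0 : T0 ≤ H0f + l0 * T2)
    (hX1 : |Xt| ≤ T * (δ / 2 * T0 + T1 / (2 * δ))) :
    -(T * (D * (δ / 2 * H0f + H1f / (2 * δ)))) + (A - D * (δ / 2 * l0 + l1 / (2 * δ)) * T) * T2
      ≤ A * T2 + 8 * T1 + C * T0 - D * Xt := by
  have hδ2 : 0 ≤ δ / 2 := by positivity
  have hδ' : 0 < 2 * δ := by positivity
  have hX2 : δ / 2 * T0 + T1 / (2 * δ) ≤ δ / 2 * (H0f + l0 * T2) + (H1f + l1 * T2) / (2 * δ) := by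
    have ha := mul_le_mul_of_nonneg_left h0 hδ2
    have hb := div_le_div_of_nonneg_right h1 hδ'.le
    linarith
  have hX3 : |Xt| ≤ T * (δ / 2 * (H0f + l0 * T2) + (H1f + l1 * T2) / (2 * δ)) :=
    hX1.trans (mul_le_mul_of_nonneg_left hX2 hT)
  have hDX : D * Xt ≤ D * (T * (δ / 2 * (H0f + l0 * T2) + (H1f + l1 * T2) / (2 * δ))) :=
    mul_le_mul_of_nonneg_left ((le_abs_self Xt).trans hX3) hD
  have hdrop : 0 ≤ 8 * T1 + C * T0 := by positivity
  have e : D * (T * (δ / 2 * (H0f + l0 * T2) + (H1f + l1 * T2) / (2 * δ)))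
      = T * (D * (δ / 2 * H0f + H1f / (2 * δ))) + D * (δ / 2 * l0 + l1 / (2 * δ)) * T * T2 := by
    field_simp
    ring
  rw [e] at hDX
  nlinarith [hDX, hdrop]

/-- **SPEC 2.7 for one real component, assembled**: with the ladders `IsLadder c a`, `IsLadder a b`, truncation `(N, P)`, window `L`, constants `C, D, T ≥ 0`,
`δ > 0` and a coupling-tail value `X_t` with `|X_t| ≤ T·√T1·√T0`:
`A·T2 + 8·T1 + C·T0 − D·X_t ≥ −T·D·((δ/2)·H0form + H1form/(2δ)) + (A − D·((δ/2)·λ0 + λ1/(2δ))·T)·T2`. -/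
theorem rem_lower_bound_seq {c a b : ℕ → ℝ} (hA : IsLadder c a) (hB : IsLadder a b) (N P L : ℕ)
    {A C D T δ Xt : ℝ} (hC : 0 ≤ C) (hD : 0 ≤ D) (hT : 0 ≤ T) (hδ : 0 < δ)
    (hX : |Xt| ≤ T * Real.sqrt (∑ k ∈ range L, w (N + 2 + k) * a (N + 2 + k) ^ 2)
                    * Real.sqrt (∑ k ∈ range L, w (N + 1 + k) * b (N + 1 + k) ^ 2)) :
    -(T * (D * (δ / 2 * H0form N P c a + H1form N P c / (2 * δ))))
        + (A - D * (δ / 2 * lam0 N P + lam1 N P / (2 * δ)) * T) * ∑ k ∈ range L, w (N + P + 4 + k) * c (N + P + 4 + k) ^ 2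
      ≤ A * ∑ k ∈ range L, w (N + P + 4 + k) * c (N + P + 4 + k) ^ 2
        + 8 * ∑ k ∈ range L, w (N + 2 + k) * a (N + 2 + k) ^ 2
        + C * ∑ k ∈ range L, w (N + 1 + k) * b (N + 1 + k) ^ 2 - D * Xt :=
  rem_lower_bound hC hD hT hδ (window_nonneg a (N + 2) L) (window_nonneg b (N + 1) L)
    (tail1_bound hA N P L) (tail0_bound hA hB N P L) hX

/-! ### Two real components (a complex `W = W₁ + i·W₂`): the claims add up -/

/-- CLAIM 1 for the sum of two components. -/
theorem pair_tail1_bound {c₁ a₁ c₂ a₂ : ℕ → ℝ} (h₁ : IsLadder c₁ a₁) (h₂ : IsLadder c₂ a₂) (N P L : ℕ) :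
    ∑ k ∈ range L, w (N + 2 + k) * a₁ (N + 2 + k) ^ 2 + ∑ k ∈ range L, w (N + 2 + k) * a₂ (N + 2 + k) ^ 2
      ≤ (H1form N P c₁ + H1form N P c₂)
        + lam1 N P * (∑ k ∈ range L, w (N + P + 4 + k) * c₁ (N + P + 4 + k) ^ 2
                        + ∑ k ∈ range L, w (N + P + 4 + k) * c₂ (N + P + 4 + k) ^ 2) := by
  have := tail1_bound h₁ N P L
  have := tail1_bound h₂ N P L
  linarith

/-- CLAIM 2 for the sum of two components. -/
theorem pair_tail0_bound {c₁ a₁ b₁ c₂ a₂ b₂ : ℕ → ℝ} (hA₁ : IsLadder c₁ a₁) (hB₁ : IsLadder a₁ b₁)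
    (hA₂ : IsLadder c₂ a₂) (hB₂ : IsLadder a₂ b₂) (N P L : ℕ) :
    ∑ k ∈ range L, w (N + 1 + k) * b₁ (N + 1 + k) ^ 2 + ∑ k ∈ range L, w (N + 1 + k) * b₂ (N + 1 + k) ^ 2
      ≤ (H0form N P c₁ a₁ + H0form N P c₂ a₂)
        + lam0 N P * (∑ k ∈ range L, w (N + P + 4 + k) * c₁ (N + P + 4 + k) ^ 2
                        + ∑ k ∈ range L, w (N + P + 4 + k) * c₂ (N + P + 4 + k) ^ 2) := by
  have := tail0_bound hA₁ hB₁ N P L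
  have := tail0_bound hA₂ hB₂ N P L
  linarith

/-- **SPEC 2.7 for a complex `W` (two real components)**: the remainder `Rem = A‖w̃₂‖² + 8‖w̃₁‖² + C‖w̃₀‖² − D·X_t` with the squared norms the
component sums of the windows, and `|X_t| ≤ T·‖w̃₁‖·‖w̃₀‖`. -/
theorem rem_lower_bound_pair {c₁ a₁ b₁ c₂ a₂ b₂ : ℕ → ℝ} (hA₁ : IsLadder c₁ a₁) (hB₁ : IsLadder a₁ b₁)
    (hA₂ : IsLadder c₂ a₂) (hB₂ : IsLadder a₂ b₂) (N P L : ℕ)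
    {A C D T δ Xt : ℝ} (hC : 0 ≤ C) (hD : 0 ≤ D) (hT : 0 ≤ T) (hδ : 0 < δ)
    (hX : |Xt| ≤ T * Real.sqrt (∑ k ∈ range L, w (N + 2 + k) * a₁ (N + 2 + k) ^ 2 + ∑ k ∈ range L, w (N + 2 + k) * a₂ (N + 2 + k) ^ 2)
                    * Real.sqrt (∑ k ∈ range L, w (N + 1 + k) * b₁ (N + 1 + k) ^ 2 + ∑ k ∈ range L, w (N + 1 + k) * b₂ (N + 1 + k) ^ 2)) :
    -(T * (D * (δ / 2 * (H0form N P c₁ a₁ + H0form N P c₂ a₂) + (H1form N P c₁ + H1form N P c₂) / (2 * δ))))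
        + (A - D * (δ / 2 * lam0 N P + lam1 N P / (2 * δ)) * T)
          * (∑ k ∈ range L, w (N + P + 4 + k) * c₁ (N + P + 4 + k) ^ 2 + ∑ k ∈ range L, w (N + P + 4 + k) * c₂ (N + P + 4 + k) ^ 2)
      ≤ A * (∑ k ∈ range L, w (N + P + 4 + k) * c₁ (N + P + 4 + k) ^ 2 + ∑ k ∈ range L, w (N + P + 4 + k) * c₂ (N + P + 4 + k) ^ 2)
        + 8 * (∑ k ∈ range L, w (N + 2 + k) * a₁ (N + 2 + k) ^ 2 + ∑ k ∈ range L, w (N + 2 + k) * a₂ (N + 2 + k) ^ 2)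
        + C * (∑ k ∈ range L, w (N + 1 + k) * b₁ (N + 1 + k) ^ 2 + ∑ k ∈ range L, w (N + 1 + k) * b₂ (N + 1 + k) ^ 2) - D * Xt :=
  rem_lower_bound hC hD hT hδ (add_nonneg (window_nonneg a₁ (N + 2) L) (window_nonneg a₂ (N + 2) L))
    (add_nonneg (window_nonneg b₁ (N + 1) L) (window_nonneg b₂ (N + 1) L))
    (pair_tail1_bound hA₁ hA₂ N P L) (pair_tail0_bound hA₁ hB₁ hA₂ hB₂ N P L) hX

/-! ### Link to the landed RULE (`ShearTailRule`, rational data of the rows) -/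

/-- `(ShearTailRule.lam1 N P : ℝ) = lam (N+P+2)` (the rule's `λ1` IS the ladder constant used above). -/
theorem lam1_cast (N P : ℕ) : ((ShearTailRule.lam1 N P : ℚ) : ℝ) = lam1 N P := by
  unfold ShearTailRule.lam1 lam1 lam
  push_cast
  ring

/-- `(ShearTailRule.mu N : ℝ) = lam N`. -/
theorem mu_cast (N : ℕ) : ((ShearTailRule.mu N : ℚ) : ℝ) = mu N := by
  unfold ShearTailRule.mu mu lam
  push_cast
  ring

/-- `(ShearTailRule.lam0 N P : ℝ) = λ0`. -/
theorem lam0_cast (N P : ℕ) : ((ShearTailRule.lam0 N P : ℚ) : ℝ) = lam0 N P := by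
  unfold ShearTailRule.lam0 lam0
  push_cast
  rw [lam1_cast, mu_cast]

/-- `(ShearTailRule.kappaTilde Γx π_lo N P m : ℝ) = D_m·((δ/2)·λ0 + λ1/(2δ))` with `D_m = ShearTailRule.Dm Γx π_lo m` and `δ = ShearTailRule.delta N` —
the coefficient of `T` multiplying `T2` in `rem_lower_bound_seq` / `_pair`. -/
theorem kappaTilde_cast (Gx piLo : ℚ) (N P m : ℕ) :
    ((ShearTailRule.kappaTilde Gx piLo N P m : ℚ) : ℝ)
      = (ShearTailRule.Dm Gx piLo m : ℝ) * ((ShearTailRule.delta N : ℝ) / 2 * lam0 N P + lam1 N P / (2 * (ShearTailRule.delta N : ℝ))) := by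
  unfold ShearTailRule.kappaTilde
  push_cast
  rw [lam0_cast, lam1_cast]

/-- **The certified scalar line is the `T2`-coefficient.** If a row's kernel-checked slack `ShearTailRule.kappaSlack Γx π_hi π_lo T N P m ≥ 0`
(files `Certs/<Row>/TailSlack.lean`: `kappaSlack_rule_nonneg`), then with `A = Am`, `D = Dm`, `δ = delta N` the coefficient
`A − D·((δ/2)·λ0 + λ1/(2δ))·T` of the `W″`-tail in `rem_lower_bound_seq` is `≥ 0` — so that tail may be dropped. -/
theorem T2_coeff_nonneg_of_kappaSlack {Gx piHi piLo T : ℚ} {N P m : ℕ}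
    (h : 0 ≤ ShearTailRule.kappaSlack Gx piHi piLo T N P m) :
    0 ≤ (ShearTailRule.Am Gx piHi m : ℝ)
        - (ShearTailRule.Dm Gx piLo m : ℝ) * ((ShearTailRule.delta N : ℝ) / 2 * lam0 N P + lam1 N P / (2 * (ShearTailRule.delta N : ℝ))) * (T : ℝ) := by
  rw [← kappaTilde_cast]
  have h' : (0 : ℝ) ≤ ((ShearTailRule.kappaSlack Gx piHi piLo T N P m : ℚ) : ℝ) := by exact_mod_cast h
  unfold ShearTailRule.kappaSlack at h'
  push_cast at h'
  exact h'

/-- Test (kernel + `norm_num`): for row R2-50, mode 1 (`N = 12`, `P = 4`): `λ1 = lam 18 = 4/(39·43)`, `μ = lam 12 = 4/(27·31)`. -/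
example : lam1 12 4 = 4 / (39 * 43) ∧ mu 12 = 4 / (27 * 31) := by
  constructor <;> norm_num [lam1, mu, lam]

end Summit.NavierStokesRegularity.TurbBounds.ShearTailSeq
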